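import Summits.HodgeConjecture.HodgeConjecture.Theorems.R90S6TorusFixedSpecialCountUnipotent    -- ★ RUNG 1 `natCard_fixedBy_special_eq_one_add_mul_of_residually_unipotent` (a₁ + ℓ₁ = 1 + S·ℓ₁)
import Summits.HodgeConjecture.HodgeConjecture.Theorems.R90S6LevelOneCountCayleyDictionary       -- ★ RUNG 2 (A) `natCard_levelOne_eq_natCard_fixedBy_of_mem_adjoin` (ℓ₁ = #Fix_Y), `finite_fixedBy_of_mem_adjoin`
import Summits.HodgeConjecture.HodgeConjecture.Theorems.R90S6FlickerLiteralShiftUnit              -- ★ sibling A (p864999): `exists_unitary_coe_eq_flickerLiteral_one∕pi`; brings ★ frames + ★ p09 Regimes letters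
import Literature.NumberTheory.Automorphic.SplitTorusOrderMoebiusShift                            -- ★ `exists_wild_cayley_literal` (vector Möbius shift: same order, norm one, kept distances), `self_mem_span_pow`
import Literature.NumberTheory.Automorphic.SplitTorusOrderCayleyShift                             -- ★ BRIDGE `conj_diagonal_mem_adjoin_of_mem_span_pow`
import Literature.NumberTheory.Rogawski1990.UnitOrbitalIntegralInertValueThetaZeroTrichotomy      -- ★ CORNER `natCard_fixedPoints_unitaryInt_corner_eq_phiZero_of_tri`
import Literature.NumberTheory.Rogawski1990.UnitOrbitalIntegralInertValueThetaOneCorner           -- ★ CORNER `natCard_fixedPoints_unitaryInt_corner_eq_phiOne`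
import HarnessLib

/-!
# R90 · S6 — LINE S1, REGIME R-I (ALL CONGRUENT), CARD «R-I TWIN»: THE FIXED SPECIAL COUNT `a₁` OF THE FLICKER LITERALS `t_1(a,b,c)`, `t_ϖ(a,b,c)` WITH
# `a ≡ b ≡ c` — `a₁ + φ(shifted depths) = 1 + S·φ(shifted depths)` (`Theorems/R90S6TorusFixedSpecialCountUnipotentFlicker.lean`)

Cell `hodgecm-mathlib`, crux H413 (`stmt-HodgeConjecture-24833`), route of record `HCCMUnconditional`; programme R90-TF, section S6 (base `R90-C14`), seat R90-C14-p05 (g2);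
S6 dealer R90-C14-plan (g2) ruling 2026-09-05T03:10:50Z «the R-I (all-congruent) twin is p05's» (consumer: p10 (g2)'s `…FlickerU3Congruent` assembly, the (E1) sheet of typ1).
Helper lane `--supports stmt-HodgeConjecture-24833 --as helper`; THEOREMS ONLY (no definition, no instance, no notation, no named fact, no `sorry`).

THE MATHEMATICS [Kottwitz1986BaseChangeUnits, §1 pp. 240–241, §3; Flicker1998UnitaryFL, Prop. 11 p. 87, Prop. 14 p. 94; Serre1980Trees, II §1.1; Rogawski1990, §4.9 Prop. 4.9.1 (b)
p. 55].  `K` complete discretely valued, non-dyadic, residue field of order `q²` (`hd`), `U = U(σ, J₀)(K)`, `K₀ ∕ K₁` the hyperspecial ∕ special stabilisers, `S = #star(L₀)`.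
For a Flicker literal `γ = T_θ(a, b, c)` (`θ ∈ {1, ϖ}`) with norm-one eigenvalues ALL RESIDUALLY CONGRUENT — depths `|a − b| = |ϖ^{N₁}|`, `|c − b| = |ϖ^{N₂}|`, `|a − c| = |ϖ^N|`,
`N₁, N ≥ 1` (hence `N₂ ≥ 1`; isosceles `htri`) — ★ RUNG 1 gives `a₁ + ℓ₁ = 1 + S·ℓ₁` with `ℓ₁` the level-one count, and ★ RUNG 2 (A) gives `ℓ₁ = #Fix_Y(U ⧸ K₀)` for ANY unit `Y` of
the shifted order `𝒪[X]`, `X = 1 + ϖ⁻¹(a⁻¹γ − 1)`.  §1 THE SHIFT (vector level, ★ `exists_wild_cayley_literal`): in the eigenframe `γ = P·diag(a,b,c)·P⁻¹`, `X = P·diag(1 + X_v)·P⁻¹` with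
`X_v = (0, ϖ⁻¹(b∕a − 1), ϖ⁻¹(c∕a − 1)) ∈ 𝒪³`, and the wild Cayley literal `Y_v,i = (X_v,i + t₀)∕(σt₀ + (ϖσt₀ − 1)X_v,i)` (`t₀` the trace-one element of `hd`) is NORM ONE, generates the SAME
order (`R_{X_v} = R_{Y_v}`, with `Y_v⁻¹ ∈ R_{Y_v}`) and KEEPS distances: `|Y_v,i − Y_v,j| = |X_v,i − X_v,j| = |t_i − t_j|∕|ϖ|` — the depths ONE LEVEL DOWN; ★ BRIDGE
`conj_diagonal_mem_adjoin_of_mem_span_pow` turns this into ★ (A)'s three adjoin letters for `Y = P·diag(Y_v)·P⁻¹ = T_θ(Y_v)`, a unitary element by ★ sibling A.  §2 THE VALUES: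
`#Fix_Y(U ⧸ K₀)` is ★ CORNER at the shifted letters, whence **`a₁(t_1(a,b,c)) + φ₀(N₁−1, N₂−1, N−1) = 1 + S·φ₀(N₁−1, N₂−1, N−1)`** and **`a₁(t_ϖ(a,b,c)) + φ₁(N₁−1, N−1) = 1 +
S·φ₁(N₁−1, N−1)`** (in `ℚ`; `S = q³ + 1` at the pins, applied by the consumer; `t_ϖ(a,c,b)`, `t_ϖ(b,a,c)` by relabelling).
HONEST LABEL: compositions (★ RUNG 1 ∘ ★ (A) ∘ ★ wild Cayley ∘ ★ bridge ∘ ★ sibling A ∘ ★ CORNER), unconditional in their letters; count-neutral until the (E1) assembly consumes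
them; proves no printed statement.  HC_CM is proved only modulo the 7 printed citations (2 remaining named inputs: hLiu418 = stmt-HodgeConjecture-24832, h413 = stmt-HodgeConjecture-24833)
until rung 0 closes.

## References
* [Kottwitz1986BaseChangeUnits] R. E. Kottwitz, *Base change for unit elements of Hecke algebras*, Compositio Math. 60 (1986) 237–250, §1 pp. 240–241, §3.
* [Flicker1998UnitaryFL] Y. Z. Flicker, *Elementary proof of the fundamental lemma for a unitary group*, Canad. J. Math. 50 (1998) 74–98, Prop. 11 p. 87, Prop. 14 p. 94.
* [Serre1980Trees] J.-P. Serre, *Trees*, Springer (1980), Ch. II §1.1.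
* [Rogawski1990] J. D. Rogawski, *Automorphic Representations of Unitary Groups in Three Variables*, Ann. of Math. Stud. 123 (1990), §4.9 Prop. 4.9.1 (b) p. 55.
-/

set_option autoImplicit false
-- the mandated namespace repeats the single-problem summit's segment (`HodgeConjecture.HodgeConjecture`)
set_option linter.dupNamespace false

noncomputable section

open MulAction Polynomial Matrix
open Literature.NumberTheory.Automorphic Literature.NumberTheory.Automorphic.HermitianLattice Literature.NumberTheory.Automorphic.UnitaryGroup
open Literature.NumberTheory.Automorphic.UnitaryLatticeTree
open Literature.NumberTheory.Rogawski1990 Literature.NumberTheory.Rogawski1990.Flicker1998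
open scoped Matrix MatrixGroups WithZero ValuativeRel

namespace Summit.HodgeConjecture.HodgeConjecture.R90.S6

universe u

variable {K : Type u} [Field K] [Valued K ℤᵐ⁰]

/-! ### §1 The shift of an all-congruent diagonalisable torus element, in a frame `P` -/

omit [Valued K ℤᵐ⁰] in
/-- Conjugation by a frame is a ring homomorphism: `1 + ϖ⁻¹(a⁻¹·(P D P⁻¹) − 1) = P·(1 + ϖ⁻¹(a⁻¹D − 1))·P⁻¹`. [cite: Serre1980Trees, Ch. II §1.1] -/
theorem one_add_smul_conj_eq (P : GL (Fin 3) K) (D : Matrix (Fin 3) (Fin 3) K) (ϖ a : K) :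
    (1 : Matrix (Fin 3) (Fin 3) K) + ϖ⁻¹ • (a⁻¹ • ((P : Matrix (Fin 3) (Fin 3) K) * D * ((P⁻¹ : GL (Fin 3) K) : Matrix (Fin 3) (Fin 3) K)) - 1) =
      (P : Matrix (Fin 3) (Fin 3) K) * (1 + ϖ⁻¹ • (a⁻¹ • D - 1)) * ((P⁻¹ : GL (Fin 3) K) : Matrix (Fin 3) (Fin 3) K) := by
  have hPP : (P : Matrix (Fin 3) (Fin 3) K) * ((P⁻¹ : GL (Fin 3) K) : Matrix (Fin 3) (Fin 3) K) = 1 := by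
    rw [← Units.val_mul, mul_inv_cancel, Units.val_one]
  rw [Matrix.mul_add, Matrix.add_mul, Matrix.mul_one, hPP, Matrix.mul_smul, Matrix.smul_mul, Matrix.mul_sub, Matrix.sub_mul, Matrix.mul_one, hPP,
    Matrix.mul_smul, Matrix.smul_mul]

omit [Valued K ℤᵐ⁰] in
/-- The shifted diagonal: `1 + ϖ⁻¹(a⁻¹·diag(a,b,c) − 1) = diag(1 + X_v)` with `X_v = (0, ϖ⁻¹(a⁻¹b − 1), ϖ⁻¹(a⁻¹c − 1))` (`a ≠ 0`). [cite: Kottwitz1986BaseChangeUnits, §3] -/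
theorem one_add_smul_diagonal_eq {ϖ a b c : K} (ha0 : a ≠ 0) :
    (1 : Matrix (Fin 3) (Fin 3) K) + ϖ⁻¹ • (a⁻¹ • diagonal ![a, b, c] - 1) =
      diagonal fun i => 1 + ![(0 : K), ϖ⁻¹ * (a⁻¹ * b - 1), ϖ⁻¹ * (a⁻¹ * c - 1)] i := by
  ext i j
  by_cases hij : i = j
  · subst hij
    fin_cases i <;> simp [inv_mul_cancel₀ ha0]
  · simp [hij]

/-- **THE SHIFT, vector level + matrix letters.**  `σ` the isometric involution of the non-dyadic unramified datum `hd`, `P` any frame, `a, b, c` norm-one with `|a − b|, |a − c| ≤ |ϖ|`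
(all congruent).  There is a norm-one vector `Y_v` with distances ONE LEVEL DOWN — `|Y_v,i − Y_v,j|·|ϖ| = |t_i − t_j|`, `t = (a,b,c)` — such that `Y = P·diag(Y_v)·P⁻¹` satisfies the
three adjoin letters of ★ RUNG 2 (A) at `u := a`: `Y, Y⁻¹ ∈ 𝒪[X]`, `X ∈ 𝒪[Y]`, `X = 1 + ϖ⁻¹(a⁻¹·PdiagP⁻¹ − 1)` (`𝒪` the `ValuativeRel` integers).  The vector is the ★ WILD CAYLEY
LITERAL of `X_v = (0, ϖ⁻¹(b∕a − 1), ϖ⁻¹(c∕a − 1))` (trace-one element from `hd`), transported by the ★ BRIDGE. [cite: Kottwitz1986BaseChangeUnits, §1 pp. 240–241, §3] [cite: Serre1980Trees, Ch. II §1.1] -/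
theorem exists_unipotent_shift_letters [ValuativeRel K] [(Valued.v : Valuation K ℤᵐ⁰).Compatible]
    {σ : K →+* K} {ϖ : K} (hd : LocalConjDatum σ ϖ) (P : GL (Fin 3) K)
    {a b c : K} (ha : σ a * a = 1) (hb : σ b * b = 1) (hc : σ c * c = 1) (hab : Valued.v (a - b) ≤ Valued.v ϖ) (hac : Valued.v (a - c) ≤ Valued.v ϖ) :
    ∃ Yv : Fin 3 → K, (∀ i, σ (Yv i) * Yv i = 1) ∧
      (∀ i j, Valued.v (Yv i - Yv j) * Valued.v ϖ = Valued.v (![a, b, c] i - ![a, b, c] j)) ∧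
      (P : Matrix (Fin 3) (Fin 3) K) * diagonal Yv * ((P⁻¹ : GL (Fin 3) K) : Matrix (Fin 3) (Fin 3) K) ∈ Algebra.adjoin 𝒪[K]
        ({1 + ϖ⁻¹ • (a⁻¹ • ((P : Matrix (Fin 3) (Fin 3) K) * diagonal ![a, b, c] * ((P⁻¹ : GL (Fin 3) K) : Matrix (Fin 3) (Fin 3) K)) - 1)} :
          Set (Matrix (Fin 3) (Fin 3) K)) ∧
      ((P : Matrix (Fin 3) (Fin 3) K) * diagonal Yv * ((P⁻¹ : GL (Fin 3) K) : Matrix (Fin 3) (Fin 3) K))⁻¹ ∈ Algebra.adjoin 𝒪[K]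
        ({1 + ϖ⁻¹ • (a⁻¹ • ((P : Matrix (Fin 3) (Fin 3) K) * diagonal ![a, b, c] * ((P⁻¹ : GL (Fin 3) K) : Matrix (Fin 3) (Fin 3) K)) - 1)} :
          Set (Matrix (Fin 3) (Fin 3) K)) ∧
      (1 + ϖ⁻¹ • (a⁻¹ • ((P : Matrix (Fin 3) (Fin 3) K) * diagonal ![a, b, c] * ((P⁻¹ : GL (Fin 3) K) : Matrix (Fin 3) (Fin 3) K)) - 1)) ∈ Algebra.adjoin 𝒪[K]
        ({(P : Matrix (Fin 3) (Fin 3) K) * diagonal Yv * ((P⁻¹ : GL (Fin 3) K) : Matrix (Fin 3) (Fin 3) K)} : Set (Matrix (Fin 3) (Fin 3) K)) := by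
  have hϖ0 : ϖ ≠ 0 := hd.ϖ_ne_zero
  have hϖ1 : Valued.v ϖ < 1 := by rw [hd.vϖ, ← WithZero.exp_zero, WithZero.exp_lt_exp]; norm_num
  have hva : Valued.v a = 1 := (flickerLiteral_norm_one_letters σ hd.vσ ha).2
  have ha0 : a ≠ 0 := fun h => by rw [h, map_zero] at hva; exact zero_ne_one hva
  -- the integral vector `X_v`
  set Xv : Fin 3 → K := ![(0 : K), ϖ⁻¹ * (a⁻¹ * b - 1), ϖ⁻¹ * (a⁻¹ * c - 1)] with hXv
  have hO : ∀ z : K, Valued.v z ≤ 1 → z ∈ 𝒪[K] := fun z hz => (v_le_one_iff_mem_integer z).1 hz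
  have hO' : ∀ z ∈ 𝒪[K], Valued.v z ≤ 1 := fun z hz => (v_le_one_iff_mem_integer z).2 hz
  have hshift : ∀ {t : K}, Valued.v (a - t) ≤ Valued.v ϖ → Valued.v (ϖ⁻¹ * (a⁻¹ * t - 1)) ≤ 1 := by
    intro t ht
    have e : ϖ⁻¹ * (a⁻¹ * t - 1) = -(ϖ⁻¹ * (a⁻¹ * (a - t))) := by field_simp; ring
    rw [e, Valuation.map_neg, map_mul, map_mul, map_inv₀, map_inv₀, hva, inv_one, one_mul]
    calc (Valued.v ϖ)⁻¹ * Valued.v (a - t) ≤ (Valued.v ϖ)⁻¹ * Valued.v ϖ := mul_le_mul' le_rfl ht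
      _ = 1 := inv_mul_cancel₀ ((Valuation.ne_zero_iff _).2 hϖ0)
  have hXO : ∀ i, Xv i ∈ 𝒪[K] := by
    intro i; fin_cases i
    · exact (𝒪[K]).zero_mem
    · exact hO _ (hshift hab)
    · exact hO _ (hshift hac)
  -- `1 + ϖ X_v,i = t_i ∕ a` is norm one
  have hshiftN : ∀ {t : K}, σ t * t = 1 → σ (1 + ϖ * (ϖ⁻¹ * (a⁻¹ * t - 1))) * (1 + ϖ * (ϖ⁻¹ * (a⁻¹ * t - 1))) = 1 := by
    intro t ht
    have e : 1 + ϖ * (ϖ⁻¹ * (a⁻¹ * t - 1)) = a⁻¹ * t := by field_simp; ring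
    rw [e, map_mul, map_inv₀]
    have hσa0 : σ a ≠ 0 := fun h => by rw [h, zero_mul] at ha; exact zero_ne_one ha
    calc (σ a)⁻¹ * σ t * (a⁻¹ * t) = (σ t * t) / (σ a * a) := by field_simp
      _ = 1 := by rw [ht, ha, div_one]
  have hN : ∀ i, σ (1 + ϖ * Xv i) * (1 + ϖ * Xv i) = 1 := by
    intro i; fin_cases i
    · show σ (1 + ϖ * 0) * (1 + ϖ * 0) = 1
      rw [mul_zero, add_zero, map_one, one_mul]
    · show σ (1 + ϖ * (ϖ⁻¹ * (a⁻¹ * b - 1))) * (1 + ϖ * (ϖ⁻¹ * (a⁻¹ * b - 1))) = 1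
      exact hshiftN hb
    · show σ (1 + ϖ * (ϖ⁻¹ * (a⁻¹ * c - 1))) * (1 + ϖ * (ϖ⁻¹ * (a⁻¹ * c - 1))) = 1
      exact hshiftN hc
  -- the trace-one element and ★ the wild Cayley literal
  obtain ⟨t₀, ht₀1, ht₀⟩ := hd.toUnramified.trace
  obtain ⟨hY1, hspan, hYinv, hdist⟩ :=
    exists_wild_cayley_literal 𝒪[K] σ hO hO' hd.σσ hd.vσ hϖ1 hϖ0 hd.σϖ ht₀ ht₀1 hXO hN
  set Yv : Fin 3 → K := fun i => (Xv i + t₀) / (σ t₀ + (ϖ * σ t₀ - 1) * Xv i) with hYv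
  have hYvO : ∀ i, Yv i ∈ 𝒪[K] := fun i => hO _ (flickerLiteral_norm_one_letters σ hd.vσ (hY1 i)).2.le
  -- the distances one level down
  have hdist' : ∀ i j, Valued.v (Yv i - Yv j) * Valued.v ϖ = Valued.v (![a, b, c] i - ![a, b, c] j) := by
    have key : ∀ i, ![a, b, c] i = a * (1 + ϖ * Xv i) := by
      intro i; fin_cases i
      · simp [hXv]
      · show b = a * (1 + ϖ * (ϖ⁻¹ * (a⁻¹ * b - 1))); field_simp; ring
      · show c = a * (1 + ϖ * (ϖ⁻¹ * (a⁻¹ * c - 1))); field_simp; ring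
    intro i j
    rw [hdist i j, key i, key j, ← mul_sub, map_mul, hva, one_mul, show (1 + ϖ * Xv i) - (1 + ϖ * Xv j) = (Xv i - Xv j) * ϖ by ring, map_mul]
  refine ⟨Yv, hY1, hdist', ?_, ?_, ?_⟩
  · -- `Y ∈ 𝒪[X]`: `Y_v ∈ R_{Y_v} = R_{X_v} = R_{1 + X_v}`
    rw [one_add_smul_conj_eq, one_add_smul_diagonal_eq ha0]
    refine conj_diagonal_mem_adjoin_of_mem_span_pow 𝒪[K] P ?_
    rw [span_pow_one_add_eq 𝒪[K] hXO, hspan]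
    exact self_mem_span_pow 𝒪[K] hYvO
  · -- `Y⁻¹ ∈ 𝒪[X]`
    have hY0 : ∀ i, Yv i ≠ 0 := fun i h => by
      have h1 : σ (Yv i) * Yv i = 1 := hY1 i
      rw [h, mul_zero] at h1; exact zero_ne_one h1
    rw [inv_conj_diagonal P hY0, one_add_smul_conj_eq, one_add_smul_diagonal_eq ha0]
    refine conj_diagonal_mem_adjoin_of_mem_span_pow 𝒪[K] P ?_
    rw [span_pow_one_add_eq 𝒪[K] hXO, hspan]
    exact hYinv
  · -- `X ∈ 𝒪[Y]`: `1 + X_v ∈ R_{X_v} = R_{Y_v}`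
    rw [one_add_smul_conj_eq, one_add_smul_diagonal_eq ha0]
    refine conj_diagonal_mem_adjoin_of_mem_span_pow 𝒪[K] P ?_
    rw [← hspan]
    exact one_add_mem_span_pow 𝒪[K] hXO

/-- Exponent bookkeeping one level down: `x·|ϖ| = |ϖ^M|`, `1 ≤ M` ⟹ `x = exp(−(M − 1))`. [cite: Serre1980Trees, Ch. II §1.1] -/
theorem eq_exp_neg_sub_one_of_mul_v_eq {σ : K →+* K} {ϖ : K} (hd : LocalConjDatum σ ϖ) {x : ℤᵐ⁰} {M : ℕ} (hM : 1 ≤ M)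
    (h : x * Valued.v ϖ = Valued.v (ϖ ^ M)) : x = WithZero.exp (-((M - 1 : ℕ) : ℤ)) := by
  have hϖ0 : Valued.v ϖ ≠ 0 := (Valuation.ne_zero_iff _).2 hd.ϖ_ne_zero
  have hx : x = Valued.v (ϖ ^ M) * (Valued.v ϖ)⁻¹ := by rw [← h, mul_assoc, mul_inv_cancel₀ hϖ0, mul_one]
  rw [hx, hd.v_pow, hd.vϖ, ← WithZero.exp_neg, ← WithZero.exp_add]
  congr 1
  omega

/-! ### §2 The values -/

section Values

variable [ValuativeRel K] [(Valued.v : Valuation K ℤᵐ⁰).Compatible]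
  [IsDiscreteValuationRing (Valued.integer K)] [Finite (IsLocalRing.ResidueField (Valued.integer K))]
  [IsAdicComplete (IsLocalRing.maximalIdeal (Valued.integer K)) (Valued.integer K)]

-- the quotient-action instances `MulAction ↥K₀ (↥K₀ ⧸ I.subgroupOf K₀)` of ★ FILE 1 ∕ ★ RUNG 1 exceed the default synthesis budget (same bump as ★ RUNG 1 ∕ ★ RUNG 2 (C))
set_option synthInstance.maxHeartbeats 400000 in
set_option maxHeartbeats 1600000 in
/-- **R-I VALUE, `θ̄ = 0`: `a₁(t_1(a,b,c)) + φ₀(N₁−1, N₂−1, N−1) = 1 + S·φ₀(N₁−1, N₂−1, N−1)`** for norm-one `a ≡ b ≡ c` of depths `|a − b| = |ϖ^{N₁}|`, `|c − b| = |ϖ^{N₂}|`,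
`|a − c| = |ϖ^N|`, `N₁, N ≥ 1`, isosceles `htri` — ★ RUNG 1's fixed-point letters VERBATIM + ★ CORNER's frame letters `hσO, hy, hq, ha₀` (as ★ RUNG 2 (C)); `S = #star(L₀)`.  ★ RUNG 1
(`c := a`) ∘ ★ (A) (`ℓ₁ = #Fix_Y`) at the §1 shift `Y = t_1(Y_v)` ∘ ★ CORNER `…corner_eq_phiZero_of_tri` at the depths one level down.
[cite: Flicker1998UnitaryFL, Prop. 14 p. 94] [cite: Kottwitz1986BaseChangeUnits, §1 pp. 240–241, §3] [cite: Rogawski1990, §4.9 Prop. 4.9.1 (b) p. 55] -/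
theorem natCard_fixedBy_special_flickerOne_add_phiZero_eq_of_unipotent
    {σ : K →+* K} {ϖ : K} (hd : LocalConjDatum σ ϖ)
    (g₁ : GL (Fin 3) K) (hg₁ : (g₁ : Matrix (Fin 3) (Fin 3) K) = Matrix.diagonal ![(1 : K), 1, ϖ])
    (γ : ↥(unitaryGroupOfForm σ ((StdForm.antidiagonal 3).over K)))
    [Fintype (fixedBy (↥(unitaryGroupOfForm σ ((StdForm.antidiagonal 3).over K)) ⧸
      (glInt 3 K).subgroupOf (unitaryGroupOfForm σ ((StdForm.antidiagonal 3).over K))) γ)]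
    (hK₁fin : (fixedBy (↥(unitaryGroupOfForm σ ((StdForm.antidiagonal 3).over K)) ⧸
      ((glInt 3 K).map (MulAut.conj g₁).toMonoidHom).subgroupOf (unitaryGroupOfForm σ ((StdForm.antidiagonal 3).over K))) γ).Finite)
    (horb : (Set.range fun n : ℕ => ((γ ^ n : ↥(unitaryGroupOfForm σ ((StdForm.antidiagonal 3).over K))) :
      ↥(unitaryGroupOfForm σ ((StdForm.antidiagonal 3).over K)) ⧸ (glInt 3 K).subgroupOf (unitaryGroupOfForm σ ((StdForm.antidiagonal 3).over K)))).Finite)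
    (r : ↥(unitaryGroupOfForm σ ((StdForm.antidiagonal 3).over K)) ⧸ (glInt 3 K).subgroupOf (unitaryGroupOfForm σ ((StdForm.antidiagonal 3).over K)) →
      ↥(unitaryGroupOfForm σ ((StdForm.antidiagonal 3).over K)))
    (hr : Function.RightInverse r QuotientGroup.mk)
    [∀ x : fixedBy (↥(unitaryGroupOfForm σ ((StdForm.antidiagonal 3).over K)) ⧸
        (glInt 3 K).subgroupOf (unitaryGroupOfForm σ ((StdForm.antidiagonal 3).over K))) γ,
      Finite (fixedBy (↥((glInt 3 K).subgroupOf (unitaryGroupOfForm σ ((StdForm.antidiagonal 3).over K))) ⧸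
        (((glInt 3 K).subgroupOf (unitaryGroupOfForm σ ((StdForm.antidiagonal 3).over K)) ⊓
          ((glInt 3 K).map (MulAut.conj g₁).toMonoidHom).subgroupOf (unitaryGroupOfForm σ ((StdForm.antidiagonal 3).over K))).subgroupOf
          ((glInt 3 K).subgroupOf (unitaryGroupOfForm σ ((StdForm.antidiagonal 3).over K)))))
        (⟨(r x.1)⁻¹ * γ * r x.1, inv_mul_mul_mem_of_smul_eq r hr γ x.2⟩ :
          ↥((glInt 3 K).subgroupOf (unitaryGroupOfForm σ ((StdForm.antidiagonal 3).over K)))))]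
    -- ★ CORNER frame letters
    (hσO : ∀ y : Valued.integer K, (σ.comp (Valued.integer K).subtype) y ∈ Valued.integer K) {y : K} (hy : y * σ y = -2)
    {q : ℕ} (hq : Nat.card (IsLocalRing.ResidueField (Valued.integer K)) = q ^ 2)
    {a₀ : Valued.integer K} (ha₀ : IsUnit (((σ.comp (Valued.integer K).subtype).codRestrict (Valued.integer K) hσO) a₀ - a₀))
    -- the literal and the regime
    {e a b c : K} (h2e : 2 * e = 1) (ha : σ a * a = 1) (hb : σ b * b = 1) (hc : σ c * c = 1)
    (hγ : (((γ : ↥(unitaryGroupOfForm σ ((StdForm.antidiagonal 3).over K))) : GL (Fin 3) K) : Matrix (Fin 3) (Fin 3) K) =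
      !![e * (a + c), 0, -(e * (a - c)); 0, b, 0; -(e * (a - c)), 0, e * (a + c)])
    {N₁ N₂ N : ℕ} (hN₁ : Valued.v (a - b) = Valued.v (ϖ ^ N₁)) (hN₂ : Valued.v (c - b) = Valued.v (ϖ ^ N₂)) (hN : Valued.v (a - c) = Valued.v (ϖ ^ N))
    (h₁ : 1 ≤ N₁) (h₃ : 1 ≤ N) (htri : (N₁ = N₂ ∧ N₁ ≤ N) ∨ (N₁ = N ∧ N₁ ≤ N₂) ∨ (N₂ = N ∧ N₂ ≤ N₁)) :
    (Nat.card (fixedBy (↥(unitaryGroupOfForm σ ((StdForm.antidiagonal 3).over K)) ⧸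
        ((glInt 3 K).map (MulAut.conj g₁).toMonoidHom).subgroupOf (unitaryGroupOfForm σ ((StdForm.antidiagonal 3).over K))) γ) : ℚ) +
        phiZero q (N₁ - 1) (N₂ - 1) (N - 1) =
      1 + (((latticeGraph σ ϖ ((StdForm.antidiagonal 3).over K)).neighborSet ⟨stdLattice K 3, 0, isSelfDualLattice_stdLattice_three hd.toUnramified⟩).ncard : ℚ) *
        phiZero q (N₁ - 1) (N₂ - 1) (N - 1) := by
  have hϖ0 : ϖ ≠ 0 := hd.ϖ_ne_zero
  have h₂ : 1 ≤ N₂ := by omega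
  have hva : Valued.v a = 1 := (flickerLiteral_norm_one_letters σ hd.vσ ha).2
  have hvc : Valued.v c = 1 := (flickerLiteral_norm_one_letters σ hd.vσ hc).2
  have vle : ∀ {M : ℕ}, 1 ≤ M → Valued.v (ϖ ^ M) ≤ Valued.v ϖ := fun {M} hM => by
    rw [hd.v_pow, hd.vϖ, WithZero.exp_le_exp]; omega
  have vlt : ∀ {M : ℕ}, 1 ≤ M → Valued.v (ϖ ^ M) < 1 := fun {M} hM => by
    rw [hd.v_pow, ← WithZero.exp_zero, WithZero.exp_lt_exp]; omega
  -- the frame `P₁` and the literal as a conjugate of a diagonal matrix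
  let P : GL (Fin 3) K := ⟨!![(1 : K), 0, 1; 0, 1, 0; -1, 0, 1], !![e, 0, -e; 0, 1, 0; e, 0, e], flickerFrame_mul_inv h2e, flickerFrameInv_mul h2e⟩
  have hPT : ∀ x y z : K, !![e * (x + z), 0, -(e * (x - z)); 0, y, 0; -(e * (x - z)), 0, e * (x + z)] =
      (P : Matrix (Fin 3) (Fin 3) K) * diagonal ![x, y, z] * ((P⁻¹ : GL (Fin 3) K) : Matrix (Fin 3) (Fin 3) K) := by
    intro x y z
    rw [Literature.NumberTheory.Rogawski1990.Flicker1998.diagonal_fin_three, literal_one_eq_conj_diagonal e x y z]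
    rfl
  -- §1: the shift
  obtain ⟨Yv, hY1, hdist, hYmem, hYinv, hXmem⟩ := exists_unipotent_shift_letters hd P ha hb hc (hN₁ ▸ vle h₁) (hN ▸ vle h₃)
  obtain ⟨Y, hYM⟩ := exists_unitary_coe_eq_flickerLiteral_one σ h2e (hY1 0) (hY1 1) (hY1 2)
  have hYdiag : diagonal Yv = diagonal ![Yv 0, Yv 1, Yv 2] := by
    congr 1; funext i; fin_cases i <;> rfl
  have hYconj : ((Y : GL (Fin 3) K) : Matrix (Fin 3) (Fin 3) K) = (P : Matrix (Fin 3) (Fin 3) K) * diagonal Yv * ((P⁻¹ : GL (Fin 3) K) : Matrix (Fin 3) (Fin 3) K) := by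
    rw [hYM, hPT, hYdiag]
  have hγconj : (((γ : ↥(unitaryGroupOfForm σ ((StdForm.antidiagonal 3).over K))) : GL (Fin 3) K) : Matrix (Fin 3) (Fin 3) K) =
      (P : Matrix (Fin 3) (Fin 3) K) * diagonal ![a, b, c] * ((P⁻¹ : GL (Fin 3) K) : Matrix (Fin 3) (Fin 3) K) := by rw [hγ, hPT]
  -- ★ (A): `ℓ₁ = #Fix_Y`
  have huu : Valued.v (a - a) < 1 := by rw [sub_self, map_zero]; exact zero_lt_one
  have hℓ := natCard_levelOne_eq_natCard_fixedBy_of_mem_adjoin hd.vσ hd.vϖ γ r hr hva ha huu Y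
    (by rw [hYconj, hγconj]; exact hYmem) (by rw [Matrix.coe_units_inv, hYconj, hγconj]; exact hYinv) (by rw [hYconj, hγconj]; exact hXmem)
  -- ★ RUNG 1 at `c := a`
  have hM : (((γ : ↥(unitaryGroupOfForm σ ((StdForm.antidiagonal 3).over K))) : GL (Fin 3) K) : Matrix (Fin 3) (Fin 3) K).charpoly =
      (X - C a) * (X - C b) * (X - C c) := by
    rw [hγ, flickerLiteral_one_eq]; exact charpoly_flickerTorusElt h2e (one_mul 1)
  have hχ := fun i => flickerLiteral_charpoly_letter_unipotent hM hva.le hvc.le (hN₁ ▸ vlt h₁) (hN ▸ vlt h₃) i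
  have h1 := natCard_fixedBy_special_eq_one_add_mul_of_residually_unipotent hd.toUnramified g₁ hg₁ γ hK₁fin horb r hr hva hχ
  rw [hℓ] at h1
  -- ★ CORNER at `Y`
  have hfinY : {x : ↥(unitaryGroupOfForm σ ((StdForm.antidiagonal 3).over K)) ⧸ unitaryInt σ ((StdForm.antidiagonal 3).over K) | Y • x = x}.Finite := by
    rw [unitaryInt_eq_glInt_subgroupOf]
    exact finite_fixedBy_of_mem_adjoin hd.vσ hd.vϖ γ hva Y (by rw [hYconj, hγconj]; exact hXmem) (Set.toFinite _)
  have hval := natCard_fixedPoints_unitaryInt_corner_eq_phiZero_of_tri σ rfl hd hσO hy hq ha₀ h2e (hY1 0) (hY1 1) (hY1 2) hYM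
    (N := N - 1) (N₁ := N₁ - 1) (N₂ := N₂ - 1)
    (eq_exp_neg_sub_one_of_mul_v_eq hd h₃ (by rw [hdist 0 2]; exact hN))
    (eq_exp_neg_sub_one_of_mul_v_eq hd h₁ (by rw [hdist 0 1]; exact hN₁))
    (eq_exp_neg_sub_one_of_mul_v_eq hd h₂ (by rw [hdist 2 1]; exact hN₂))
    (by omega) hfinY
  rw [unitaryInt_eq_glInt_subgroupOf] at hval
  change (Nat.card (fixedBy (↥(unitaryGroupOfForm σ ((StdForm.antidiagonal 3).over K)) ⧸
      (glInt 3 K).subgroupOf (unitaryGroupOfForm σ ((StdForm.antidiagonal 3).over K))) Y) : ℚ) = _ at hval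
  -- cast the rung-1 identity to `ℚ`
  have h1' := congrArg (Nat.cast : ℕ → ℚ) h1
  simp only [Nat.cast_add, Nat.cast_mul, Nat.cast_one] at h1'
  rw [hval] at h1'
  exact h1'

set_option synthInstance.maxHeartbeats 400000 in
set_option maxHeartbeats 1600000 in
/-- **R-I VALUE, `θ̄ = 1`: `a₁(t_ϖ(a,b,c)) + φ₁(N₁−1, N−1) = 1 + S·φ₁(N₁−1, N−1)`** for norm-one `a ≡ b ≡ c` of depths `|a − b| = |ϖ^{N₁}|`, `|c − b| = |ϖ^{N₂}|`,
`|a − c| = |ϖ^N|`, `N₁, N ≥ 1` — same composition with the `D_ϖP₁`-frame, ★ sibling A's `t_ϖ` unitary lift and ★ CORNER `…corner_eq_phiOne` (`N₁ = ord(x − y)`, `N = ord(x − z)` slots);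
`t_ϖ(a,c,b)`, `t_ϖ(b,a,c)` are this theorem after relabelling. [cite: Flicker1998UnitaryFL, Prop. 11 p. 87] [cite: Kottwitz1986BaseChangeUnits, §1 pp. 240–241, §3] [cite: Rogawski1990, §4.9 Prop. 4.9.1 (b) p. 55] -/
theorem natCard_fixedBy_special_flickerPi_add_phiOne_eq_of_unipotent
    {σ : K →+* K} {ϖ : K} (hd : LocalConjDatum σ ϖ)
    (g₁ : GL (Fin 3) K) (hg₁ : (g₁ : Matrix (Fin 3) (Fin 3) K) = Matrix.diagonal ![(1 : K), 1, ϖ])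
    (γ : ↥(unitaryGroupOfForm σ ((StdForm.antidiagonal 3).over K)))
    [Fintype (fixedBy (↥(unitaryGroupOfForm σ ((StdForm.antidiagonal 3).over K)) ⧸
      (glInt 3 K).subgroupOf (unitaryGroupOfForm σ ((StdForm.antidiagonal 3).over K))) γ)]
    (hK₁fin : (fixedBy (↥(unitaryGroupOfForm σ ((StdForm.antidiagonal 3).over K)) ⧸
      ((glInt 3 K).map (MulAut.conj g₁).toMonoidHom).subgroupOf (unitaryGroupOfForm σ ((StdForm.antidiagonal 3).over K))) γ).Finite)
    (horb : (Set.range fun n : ℕ => ((γ ^ n : ↥(unitaryGroupOfForm σ ((StdForm.antidiagonal 3).over K))) :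
      ↥(unitaryGroupOfForm σ ((StdForm.antidiagonal 3).over K)) ⧸ (glInt 3 K).subgroupOf (unitaryGroupOfForm σ ((StdForm.antidiagonal 3).over K)))).Finite)
    (r : ↥(unitaryGroupOfForm σ ((StdForm.antidiagonal 3).over K)) ⧸ (glInt 3 K).subgroupOf (unitaryGroupOfForm σ ((StdForm.antidiagonal 3).over K)) →
      ↥(unitaryGroupOfForm σ ((StdForm.antidiagonal 3).over K)))
    (hr : Function.RightInverse r QuotientGroup.mk)
    [∀ x : fixedBy (↥(unitaryGroupOfForm σ ((StdForm.antidiagonal 3).over K)) ⧸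
        (glInt 3 K).subgroupOf (unitaryGroupOfForm σ ((StdForm.antidiagonal 3).over K))) γ,
      Finite (fixedBy (↥((glInt 3 K).subgroupOf (unitaryGroupOfForm σ ((StdForm.antidiagonal 3).over K))) ⧸
        (((glInt 3 K).subgroupOf (unitaryGroupOfForm σ ((StdForm.antidiagonal 3).over K)) ⊓
          ((glInt 3 K).map (MulAut.conj g₁).toMonoidHom).subgroupOf (unitaryGroupOfForm σ ((StdForm.antidiagonal 3).over K))).subgroupOf
          ((glInt 3 K).subgroupOf (unitaryGroupOfForm σ ((StdForm.antidiagonal 3).over K)))))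
        (⟨(r x.1)⁻¹ * γ * r x.1, inv_mul_mul_mem_of_smul_eq r hr γ x.2⟩ :
          ↥((glInt 3 K).subgroupOf (unitaryGroupOfForm σ ((StdForm.antidiagonal 3).over K)))))]
    (hσO : ∀ y : Valued.integer K, (σ.comp (Valued.integer K).subtype) y ∈ Valued.integer K) {y : K} (hy : y * σ y = -2)
    {q : ℕ} (hq : Nat.card (IsLocalRing.ResidueField (Valued.integer K)) = q ^ 2)
    {a₀ : Valued.integer K} (ha₀ : IsUnit (((σ.comp (Valued.integer K).subtype).codRestrict (Valued.integer K) hσO) a₀ - a₀))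
    {e a b c : K} (h2e : 2 * e = 1) (ha : σ a * a = 1) (hb : σ b * b = 1) (hc : σ c * c = 1)
    (hγ : (((γ : ↥(unitaryGroupOfForm σ ((StdForm.antidiagonal 3).over K))) : GL (Fin 3) K) : Matrix (Fin 3) (Fin 3) K) =
      !![e * (a + c), 0, -(e * (a - c) * ϖ); 0, b, 0; -(e * (a - c) * ϖ⁻¹), 0, e * (a + c)])
    {N₁ N₂ N : ℕ} (hN₁ : Valued.v (a - b) = Valued.v (ϖ ^ N₁)) (hN₂ : Valued.v (c - b) = Valued.v (ϖ ^ N₂)) (hN : Valued.v (a - c) = Valued.v (ϖ ^ N))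
    (h₁ : 1 ≤ N₁) (h₃ : 1 ≤ N) :
    (Nat.card (fixedBy (↥(unitaryGroupOfForm σ ((StdForm.antidiagonal 3).over K)) ⧸
        ((glInt 3 K).map (MulAut.conj g₁).toMonoidHom).subgroupOf (unitaryGroupOfForm σ ((StdForm.antidiagonal 3).over K))) γ) : ℚ) +
        phiOne q (N₁ - 1) (N - 1) =
      1 + (((latticeGraph σ ϖ ((StdForm.antidiagonal 3).over K)).neighborSet ⟨stdLattice K 3, 0, isSelfDualLattice_stdLattice_three hd.toUnramified⟩).ncard : ℚ) *
        phiOne q (N₁ - 1) (N - 1) := by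
  have hϖ0 : ϖ ≠ 0 := hd.ϖ_ne_zero
  have hϖϖ : ϖ * ϖ⁻¹ = 1 := mul_inv_cancel₀ hϖ0
  have h₂ : 1 ≤ N₂ := by
    -- `|c − b| ≤ max(|c − a|, |a − b|) < 1`
    by_contra h0
    have hN₂0 : N₂ = 0 := by omega
    have hlt : Valued.v (c - b) < 1 := by
      have e' : c - b = (a - b) - (a - c) := by ring
      rw [e']
      refine Valuation.map_sub_lt _ ?_ ?_
      · rw [hN₁, hd.v_pow, ← WithZero.exp_zero, WithZero.exp_lt_exp]; omega
      · rw [hN, hd.v_pow, ← WithZero.exp_zero, WithZero.exp_lt_exp]; omega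
    rw [hN₂, hN₂0, pow_zero, map_one] at hlt
    exact lt_irrefl _ hlt
  have hva : Valued.v a = 1 := (flickerLiteral_norm_one_letters σ hd.vσ ha).2
  have hvc : Valued.v c = 1 := (flickerLiteral_norm_one_letters σ hd.vσ hc).2
  have vle : ∀ {M : ℕ}, 1 ≤ M → Valued.v (ϖ ^ M) ≤ Valued.v ϖ := fun {M} hM => by
    rw [hd.v_pow, hd.vϖ, WithZero.exp_le_exp]; omega
  have vlt : ∀ {M : ℕ}, 1 ≤ M → Valued.v (ϖ ^ M) < 1 := fun {M} hM => by
    rw [hd.v_pow, ← WithZero.exp_zero, WithZero.exp_lt_exp]; omega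
  -- the frame `D_ϖ P₁`
  let P : GL (Fin 3) K :=
    ⟨!![ϖ, 0, 0; 0, 1, 0; 0, 0, 1] * !![(1 : K), 0, 1; 0, 1, 0; -1, 0, 1], !![e, 0, -e; 0, 1, 0; e, 0, e] * !![ϖ⁻¹, 0, 0; 0, 1, 0; 0, 0, 1],
      flickerFramePi_mul_inv h2e hϖϖ, flickerFramePiInv_mul h2e hϖϖ⟩
  have hPT : ∀ x y z : K, !![e * (x + z), 0, -(e * (x - z) * ϖ); 0, y, 0; -(e * (x - z) * ϖ⁻¹), 0, e * (x + z)] =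
      (P : Matrix (Fin 3) (Fin 3) K) * diagonal ![x, y, z] * ((P⁻¹ : GL (Fin 3) K) : Matrix (Fin 3) (Fin 3) K) := by
    intro x y z
    rw [Literature.NumberTheory.Rogawski1990.Flicker1998.diagonal_fin_three, literal_pi_eq_conj_diagonal hϖϖ x y z]
    rfl
  -- §1: the shift
  obtain ⟨Yv, hY1, hdist, hYmem, hYinv, hXmem⟩ := exists_unipotent_shift_letters hd P ha hb hc (hN₁ ▸ vle h₁) (hN ▸ vle h₃)
  obtain ⟨Y, hYM⟩ := exists_unitary_coe_eq_flickerLiteral_pi σ h2e hϖϖ hd.σϖ (hY1 0) (hY1 1) (hY1 2)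
  have hYdiag : diagonal Yv = diagonal ![Yv 0, Yv 1, Yv 2] := by
    congr 1; funext i; fin_cases i <;> rfl
  have hYconj : ((Y : GL (Fin 3) K) : Matrix (Fin 3) (Fin 3) K) = (P : Matrix (Fin 3) (Fin 3) K) * diagonal Yv * ((P⁻¹ : GL (Fin 3) K) : Matrix (Fin 3) (Fin 3) K) := by
    rw [hYM, hPT, hYdiag]
  have hγconj : (((γ : ↥(unitaryGroupOfForm σ ((StdForm.antidiagonal 3).over K))) : GL (Fin 3) K) : Matrix (Fin 3) (Fin 3) K) =
      (P : Matrix (Fin 3) (Fin 3) K) * diagonal ![a, b, c] * ((P⁻¹ : GL (Fin 3) K) : Matrix (Fin 3) (Fin 3) K) := by rw [hγ, hPT]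
  -- ★ (A): `ℓ₁ = #Fix_Y`
  have huu : Valued.v (a - a) < 1 := by rw [sub_self, map_zero]; exact zero_lt_one
  have hℓ := natCard_levelOne_eq_natCard_fixedBy_of_mem_adjoin hd.vσ hd.vϖ γ r hr hva ha huu Y
    (by rw [hYconj, hγconj]; exact hYmem) (by rw [Matrix.coe_units_inv, hYconj, hγconj]; exact hYinv) (by rw [hYconj, hγconj]; exact hXmem)
  -- ★ RUNG 1 at `c := a`
  have hM : (((γ : ↥(unitaryGroupOfForm σ ((StdForm.antidiagonal 3).over K))) : GL (Fin 3) K) : Matrix (Fin 3) (Fin 3) K).charpoly =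
      (X - C a) * (X - C b) * (X - C c) := by
    rw [hγ]; exact charpoly_flickerTorusElt h2e hϖϖ
  have hχ := fun i => flickerLiteral_charpoly_letter_unipotent hM hva.le hvc.le (hN₁ ▸ vlt h₁) (hN ▸ vlt h₃) i
  have h1 := natCard_fixedBy_special_eq_one_add_mul_of_residually_unipotent hd.toUnramified g₁ hg₁ γ hK₁fin horb r hr hva hχ
  rw [hℓ] at h1
  -- ★ CORNER at `Y`
  have hfinY : {x : ↥(unitaryGroupOfForm σ ((StdForm.antidiagonal 3).over K)) ⧸ unitaryInt σ ((StdForm.antidiagonal 3).over K) | Y • x = x}.Finite := by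
    rw [unitaryInt_eq_glInt_subgroupOf]
    exact finite_fixedBy_of_mem_adjoin hd.vσ hd.vϖ γ hva Y (by rw [hYconj, hγconj]; exact hXmem) (Set.toFinite _)
  have ev : ∀ {x : ℤᵐ⁰} {M : ℕ}, 1 ≤ M → x * Valued.v ϖ = Valued.v (ϖ ^ M) → x = Valued.v (ϖ ^ (M - 1)) := fun {x M} hM h => by
    rw [eq_exp_neg_sub_one_of_mul_v_eq hd hM h, hd.v_pow]
  have hval := natCard_fixedPoints_unitaryInt_corner_eq_phiOne σ rfl hd hσO hy hq ha₀ h2e (hY1 0) (hY1 1) (hY1 2) hYM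
    (N := N - 1) (N₁ := N₁ - 1) (N₂ := N₂ - 1)
    (ev h₃ (by rw [hdist 0 2]; exact hN)) (ev h₁ (by rw [hdist 0 1]; exact hN₁)) (ev h₂ (by rw [hdist 2 1]; exact hN₂)) hfinY
  rw [unitaryInt_eq_glInt_subgroupOf] at hval
  change (Nat.card (fixedBy (↥(unitaryGroupOfForm σ ((StdForm.antidiagonal 3).over K)) ⧸
      (glInt 3 K).subgroupOf (unitaryGroupOfForm σ ((StdForm.antidiagonal 3).over K))) Y) : ℚ) = _ at hval
  have h1' := congrArg (Nat.cast : ℕ → ℚ) h1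
  simp only [Nat.cast_add, Nat.cast_mul, Nat.cast_one] at h1'
  rw [hval] at h1'
  exact h1'

end Values

end Summit.HodgeConjecture.HodgeConjecture.R90.S6

end
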